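/-
Copyright (c) 2026 the pub-hodgecm-mathlib formalisation cell (harness21).  Prover seat hodgecm-mathlib-K2E4-p14 (g8), Track B ∕ K2-LIT, h413 = `stmt-HodgeConjecture-24833`,
line `K2_E1_TraceFormulaBeta`, campaign «EIS-R7-BL-SPH-3», deal (133)∕(165) of the dealer K2E1-plan (g7) «capstone₃ ASSEMBLY» FILE B (K2E4-p10 (g6)'s plan, HANDOFF-g6-to-g7 §OPEN
DEAL): the whole chain EXPORTS₃ ⟶ (L4) glue on ball domains ⟶ ★ `hreg_cm_three_of_letters` ⟶ ★ `sphericalEisenstein_continuation_cm_three_of_letters`, HYPOTHESIS-FIRST on the two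
Maass–Selberg letters (MS-2)∕(MS-P) of the operator road (ruling (158): one level per ball, visible at `z₀ = 2` and at the real poles).
-/
import Summits.HodgeConjecture.HodgeConjecture.Theorems.K2E1SphericalEisensteinRegularRemainderCMThreeOnDomain      -- ★∕📤 FILE A (this seat): `hres_cm_three_on_domain`, `hbdd_cm_three_on_domain`; brings ★ p859836 and the (L4) bricks
import Summits.HodgeConjecture.HodgeConjecture.Theorems.K2E1SphericalEisensteinContinuationCMThreeOfLetters          -- ★ p859307 capstone₃ engine `sphericalEisenstein_continuation_cm_three_of_letters`
import Summits.HodgeConjecture.HodgeConjecture.Theorems.K2E1SphericalConstantTermContinuationCMThree                -- ★ p859458 (this seat, g7): (L3)₃ `sphericalConstantTerm_continuation_cm_three_one`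
import Summits.HodgeConjecture.HodgeConjecture.Theorems.K2E1SphericalEisensteinContinuationU3Final                   -- ★ (this seat, g6): (Ξ₂)₃ `borelConstantTerm_sphericalEisenstein_cm_three`
import Summits.HodgeConjecture.HodgeConjecture.Theorems.K2E1SphericalEisensteinPoleExclusionCMThree                  -- ★ p859741 (K2E1-p11): §1 `countable_ball_diff_of_codiscrete`
import Summits.HodgeConjecture.HodgeConjecture.Theorems.K2E1BLLiftIntegrabilityU                                    -- ★ p859529: `lift_quotientSubgroup_mul` (left invariance from (E5))
import HarnessLib

/-!
# K2·E1 — `K2E1SphericalEisensteinPoleControlCMThreeFinal` (capstone₃ ASSEMBLY, FILE B): «(H4-b)₃-sph» FROM THE EXPORTS₃ OBJECTS AND THE OPERATOR ROAD, MODULO THE TWO MAASS–SELBERG LETTERS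

Track B ∕ K2-LIT, crux h413 = `stmt-HodgeConjecture-24833`, route of record `HCCMUnconditional`; cell `hodgecm-mathlib`, squad K2, ENGINE E1, campaign EIS-R7-BL-SPH-3.  THEOREMS ONLY
(no `def`, no `instance`, no notation, no named-fact hypothesis, no `sorry`); lane `--supports stmt-HodgeConjecture-24833 --as helper` (count-neutral).  Closes no socket.

WHAT.  BINDER FORM on the objects of ★ X2b₃ `sphericalEisenstein_meromorphic_exports_cm_three` (K2E4-p14, p859724: the continued family `Ec`, its pole set `P`, the per-ball holomorphy
sets `U n`, test functions `h n j`, vector solutions `vX n` with the pointwise representation (E5); per-ball index `n` = the ball `D_{n+1} = ball 0 ((n+1)+2)`) and on the operator road's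
per-ball truncated `L²` families `Fam n` at ONE level `T₀ n ≥ 1` on `U n ∖ P` (★ closer₃ `exists_truncatedFamily_cm_three`, K2E1-p11), HYPOTHESIS-FIRST on exactly the two Maass–Selberg letters
(ruling (158)∕(165)): **(MS-2)** `∃ C, ∀ᶠ z in 𝓝[≠] 2, ‖(z−2)•Fam 2 z‖ ≤ C` (the ball `D₃ = ball 0 5 ∋ 2`) and **(MS-P)** `∀ n, ∀ z₀ ∈ P, 1 < Re z₀ → z₀ ≠ 2 → z₀ ∈ ball 0 ((n+1)+2) →
∃ C, ∀ᶠ z in 𝓝[≠] z₀, ‖Fam n z‖ ≤ C` (payable for non-real `z₀` by K2E1-p11's `…L2BoundOffAxisCMThree`; the real poles and `z₀ = 2` stay visible).  CONCLUSION = the capstone₃ shape of ★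
`sphericalEisenstein_continuation_cm_three_of_letters`: `∃ r ≠ 0, ∀ g, ∃ Ẽ_g` meromorphic on `{1 < Re}`, holomorphic off `2`, `= E(φ₀H^z)(g)` for `Re z > 2`, `(z − 2)Ẽ_g(z) → φ₀·r`.
PROOF (K2E4-p10's plan): (L3)₃ `c` from ★ `sphericalConstantTerm_continuation_cm_three_one` and its tube constant term ★ (Ξ₂)₃; §1 the BALL DOMAIN `D(n) := ({1 < Re} ∩ ball 0 ((n+1)+2) ∩
U n) ∖ (P ∪ {2})` — open, preconnected (★ `isPreconnected_convex_diff_of_countable`: convex open minus countable), inside `{1 < Re} ∖ {2}`, with a tube point `σ₀ ∈ (3, 4)` carrying a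
neighbourhood in `D(n)` (co-discreteness of `U n` at `3`, `P ⊆ {Re ≤ 2}`), a punctured ball around `2`, and eventual punctured neighbourhoods of every `z₀` of the ball with `1 < Re z₀`;
left-`G(L⁺)`-invariance of `Ec z` on `U n ∖ P` from (E5) (★ `lift_quotientSubgroup_mul`); ★ FILE A `hres_cm_three_on_domain` on `D(2)` with (MS-2) and `hbdd_cm_three_on_domain` on
`D(max 2 ⌈‖z₀‖⌉₊)` with (MS-P); ★ `hreg_cm_three_of_letters` (pole set `P ∪ {2}`); ★ `sphericalEisenstein_continuation_cm_three_of_letters`.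
* §1 `exists_ballDomain` (topology of `D(n)`), `ecinv_of_E5` (left invariance on `U n ∖ P`); §2 HEAD **`sphericalEisenstein_continuation_cm_three_of_road`**.
HONEST LABEL: HC_CM is proved only modulo the 7 printed citations (2 remaining named inputs: hLiu418 = `stmt-HodgeConjecture-24832`, h413 = `stmt-HodgeConjecture-24833`) until rung 0
closes; this file asserts no named fact and closes no socket; the head is CONDITIONAL on (MS-2)∕(MS-P) (visible binders) and on the EXPORTS₃∕closer₃ objects it is fed.
References: [MoeglinWaldspurger1995] IV.1.9–IV.1.11, IV.3.12 · [Langlands1976] §7 · [BernsteinLapid2019] Thm 2.3, §4 p. 10 · [Garrett2018] §11.3.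
-/

set_option autoImplicit false
-- the mandated namespace repeats the single-problem summit's segment (`HodgeConjecture.HodgeConjecture`)
set_option linter.dupNamespace false

noncomputable section

open MeasureTheory Measure NumberField Set Filter Topology
open scoped ENNReal NNReal
open Literature.NumberTheory.Automorphic Literature.NumberTheory.Automorphic.UnitaryGroup AdelicGroupData
open Summit.HodgeConjecture.HodgeConjecture.Cruxes.H413.K2E1BorelEisensteinU
open Summit.HodgeConjecture.HodgeConjecture.Cruxes.H413.K2E1BLBorelSpacesU2Defs
open Summit.HodgeConjecture.HodgeConjecture.Cruxes.H413.K2E1SphericalEisensteinRegularRemainderCMThreeOnDomain (hres_cm_three_on_domain hbdd_cm_three_on_domain)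
open Summit.HodgeConjecture.HodgeConjecture.Cruxes.H413.K2E1SphericalEisensteinRegularRemainderCMThreeOfLetters (hreg_cm_three_of_letters)
open Summit.HodgeConjecture.HodgeConjecture.Cruxes.H413.K2E1SphericalEisensteinContinuationCMThreeOfLetters (sphericalEisenstein_continuation_cm_three_of_letters)
open Summit.HodgeConjecture.HodgeConjecture.Cruxes.H413.K2E1SphericalConstantTermContinuationCMThree (sphericalConstantTerm_continuation_cm_three_one)
open Summit.HodgeConjecture.HodgeConjecture.Cruxes.H413.K2E1SphericalEisensteinContinuationU3Final (borelConstantTerm_sphericalEisenstein_cm_three)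
open Summit.HodgeConjecture.HodgeConjecture.Cruxes.H413.K2E1SphericalEisensteinPoleExclusionCMThree (countable_ball_diff_of_codiscrete)
open Summit.HodgeConjecture.HodgeConjecture.Cruxes.H413.K2E1ConvexDiffCountableConnected (isPreconnected_convex_diff_of_countable countable_of_codiscrete)
open Summit.HodgeConjecture.HodgeConjecture.Cruxes.H413.K2E1BLLiftIntegrabilityU (lift_quotientSubgroup_mul)

namespace Summit.HodgeConjecture.HodgeConjecture.Cruxes.H413.K2E1SphericalEisensteinPoleControlCMThreeFinal

/-! ## §1 The ball domains and the left invariance from (E5) -/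

/-- **THE BALL DOMAIN `D = ({1 < Re} ∩ ball 0 R ∩ U) ∖ (P ∪ {2})`** (`R ≥ 5`; `U` open and co-discrete in `ball 0 R`; `P` closed, co-discrete, `⊆ {Re ≤ 2}`): open, preconnected
(convex open minus countable, ★ `isPreconnected_convex_diff_of_countable`), inside `{1 < Re} ∖ {2}`, with a tube point `σ₀ > 2` carrying a neighbourhood in `D`, a punctured ball
`B(2,ρ) ∖ {2} ⊆ D`, and an eventual punctured neighbourhood in `D` of every `z₀ ∈ ball 0 R` with `1 < Re z₀`. [cite: BernsteinLapid2019, §4 p. 10] -/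
theorem exists_ballDomain {R : ℝ} (hR : 5 ≤ R) {U P : Set ℂ} (hUo : IsOpen U)
    (hUcd : ∀ z₀ ∈ Metric.ball (0 : ℂ) R, ∀ᶠ s in 𝓝[≠] z₀, s ∈ U) (hPc : IsClosed P) (hPcd : ∀ z₀ : ℂ, ∀ᶠ s in 𝓝[≠] z₀, s ∉ P) (hPre : ∀ z ∈ P, z.re ≤ 2) :
    ∃ D : Set ℂ, D = ({z : ℂ | 1 < z.re} ∩ Metric.ball (0 : ℂ) R ∩ U) \ (P ∪ {2}) ∧ IsOpen D ∧ IsPreconnected D ∧ D ⊆ {z : ℂ | 1 < z.re} \ {2} ∧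
      (∃ σ₀ : ℝ, 2 < σ₀ ∧ ∀ᶠ z in 𝓝 ((σ₀ : ℝ) : ℂ), z ∈ D) ∧ (∃ ρ : ℝ, 0 < ρ ∧ ∀ z : ℂ, z ≠ 2 → dist z 2 < ρ → z ∈ D) ∧
      ∀ z₀ ∈ Metric.ball (0 : ℂ) R, 1 < z₀.re → ∀ᶠ z in 𝓝[≠] z₀, z ∈ D := by
  have hO1 : IsOpen {z : ℂ | 1 < z.re} := isOpen_lt continuous_const Complex.continuous_re
  refine ⟨_, rfl, ((hO1.inter Metric.isOpen_ball).inter hUo).sdiff (hPc.union isClosed_singleton), ?_, ?_, ?_, ?_, ?_⟩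
  · -- preconnected: `D = C ∖ S`, `C = {1 < Re} ∩ ball` convex open, `S = (ball ∖ U) ∪ (P ∪ {2})` countable
    have hset : ({z : ℂ | 1 < z.re} ∩ Metric.ball (0 : ℂ) R ∩ U) \ (P ∪ {2}) =
        ({z : ℂ | 1 < z.re} ∩ Metric.ball (0 : ℂ) R) \ ((Metric.ball (0 : ℂ) R \ U) ∪ (P ∪ {2})) :=
      Set.ext fun z => ⟨fun ⟨⟨⟨h1, hb⟩, hU⟩, hn⟩ => ⟨⟨h1, hb⟩, fun h => h.elim (fun h' => h'.2 hU) hn⟩,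
        fun ⟨⟨h1, hb⟩, hn⟩ => ⟨⟨⟨h1, hb⟩, by_contra fun hU => hn (Or.inl ⟨hb, hU⟩)⟩, fun h => hn (Or.inr h)⟩⟩
    rw [hset]
    exact isPreconnected_convex_diff_of_countable Literature.Topology.Euclidean.one_lt_rank_real_complex ((convex_halfSpace_re_gt 1).inter (convex_ball (0 : ℂ) R))
      (hO1.inter Metric.isOpen_ball) ((countable_ball_diff_of_codiscrete hUcd).union ((countable_of_codiscrete hPcd).union (Set.countable_singleton 2)))
  · exact fun z hz => ⟨hz.1.1.1, fun h2 => hz.2 (Or.inr h2)⟩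
  · -- a tube point: a punctured ball around `3` lies in `U`; its right half-ball is in `D`
    have h3 : ((3 : ℝ) : ℂ) ∈ Metric.ball (0 : ℂ) R := by
      rw [mem_ball_zero_iff, Complex.norm_real, Real.norm_eq_abs, abs_of_pos (by norm_num : (0 : ℝ) < 3)]; linarith
    obtain ⟨ε, hε, hεU⟩ := Metric.eventually_nhds_iff_ball.1 (eventually_nhdsWithin_iff.1 (hUcd _ h3))
    refine ⟨3 + min ε 1 / 2, by linarith [lt_min hε one_pos], ?_⟩
    have hm : 0 < min ε 1 := lt_min hε one_pos
    filter_upwards [Metric.ball_mem_nhds (((3 + min ε 1 / 2 : ℝ)) : ℂ) (half_pos hm)] with z hz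
    rw [Metric.mem_ball, Complex.dist_eq] at hz
    have hre : 3 < z.re := by
      have h1 : |z.re - (3 + min ε 1 / 2)| ≤ ‖z - (((3 + min ε 1 / 2 : ℝ)) : ℂ)‖ := by
        simpa only [Complex.sub_re, Complex.ofReal_re] using Complex.abs_re_le_norm (z - (((3 + min ε 1 / 2 : ℝ)) : ℂ))
      have := (abs_lt.1 (h1.trans_lt hz)).1; linarith
    have hz3 : z ≠ ((3 : ℝ) : ℂ) := fun h => by rw [h, Complex.ofReal_re] at hre; exact lt_irrefl _ hre
    have e1 : ‖(((3 + min ε 1 / 2 : ℝ)) : ℂ) - ((3 : ℝ) : ℂ)‖ = min ε 1 / 2 := by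
      rw [← Complex.ofReal_sub, Complex.norm_real, Real.norm_eq_abs, abs_of_pos (by linarith)]; ring
    have e2 : ‖(((3 + min ε 1 / 2 : ℝ)) : ℂ)‖ = 3 + min ε 1 / 2 := by
      rw [Complex.norm_real, Real.norm_eq_abs, abs_of_pos (by linarith)]
    have hzball3 : z ∈ Metric.ball (((3 : ℝ)) : ℂ) ε := by
      rw [Metric.mem_ball, Complex.dist_eq]
      calc ‖z - ((3 : ℝ) : ℂ)‖ ≤ ‖z - (((3 + min ε 1 / 2 : ℝ)) : ℂ)‖ + ‖(((3 + min ε 1 / 2 : ℝ)) : ℂ) - ((3 : ℝ) : ℂ)‖ := norm_sub_le_norm_sub_add_norm_sub _ _ _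
        _ < min ε 1 / 2 + min ε 1 / 2 := add_lt_add_of_lt_of_le hz e1.le
        _ ≤ ε := by linarith [min_le_left ε 1]
    have hzR : z ∈ Metric.ball (0 : ℂ) R := by
      rw [mem_ball_zero_iff]
      calc ‖z‖ ≤ ‖z - (((3 + min ε 1 / 2 : ℝ)) : ℂ)‖ + ‖(((3 + min ε 1 / 2 : ℝ)) : ℂ)‖ := norm_le_norm_sub_add _ _
        _ < min ε 1 / 2 + (3 + min ε 1 / 2) := add_lt_add_of_lt_of_le hz e2.le
        _ ≤ 5 := by linarith [min_le_right ε 1]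
        _ ≤ R := hR
    exact ⟨⟨⟨by show (1 : ℝ) < z.re; linarith, hzR⟩, hεU z hzball3 hz3⟩, by
      rintro (hP | h2)
      · linarith [hPre z hP]
      · rw [mem_singleton_iff] at h2; rw [h2, Complex.re_ofNat] at hre; linarith⟩
  · -- a punctured ball around `2` inside `D`
    have h2 : (2 : ℂ) ∈ Metric.ball (0 : ℂ) R := by
      rw [mem_ball_zero_iff]
      have : ‖(2 : ℂ)‖ = 2 := by simp
      linarith
    obtain ⟨ε, hε, hεUP⟩ := Metric.eventually_nhds_iff_ball.1 (eventually_nhdsWithin_iff.1 ((hUcd _ h2).and (hPcd 2)))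
    refine ⟨min ε 1, lt_min hε one_pos, fun z hz2 hz => ?_⟩
    have hzε : z ∈ Metric.ball (2 : ℂ) ε := Metric.mem_ball.2 (hz.trans_le (min_le_left _ _))
    have h1 : |z.re - 2| ≤ dist z 2 := by
      rw [Complex.dist_eq]; simpa only [Complex.sub_re, Complex.re_ofNat] using Complex.abs_re_le_norm (z - 2)
    have hre : 1 < z.re := by have := (abs_lt.1 (h1.trans_lt (hz.trans_le (min_le_right _ _)))).1; linarith
    have hzR : z ∈ Metric.ball (0 : ℂ) R := by
      rw [mem_ball_zero_iff]
      calc ‖z‖ ≤ dist z 2 + ‖(2 : ℂ)‖ := by rw [Complex.dist_eq]; exact norm_le_norm_sub_add z 2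
        _ < 1 + 2 := by
            have : ‖(2 : ℂ)‖ = 2 := by simp
            linarith [hz.trans_le (min_le_right ε 1)]
        _ ≤ R := by linarith
    exact ⟨⟨⟨hre, hzR⟩, (hεUP z hzε hz2).1⟩, by
      rintro (hP | h2')
      · exact (hεUP z hzε hz2).2 hP
      · exact hz2 h2'⟩
  · -- eventual punctured neighbourhoods in `D` of every `z₀` of the ball with `1 < Re z₀`
    intro z₀ hz₀ hz₀re
    have hne2 : ∀ᶠ z in 𝓝[≠] z₀, z ≠ (2 : ℂ) := by
      by_cases h : z₀ = 2
      · rw [h]; exact self_mem_nhdsWithin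
      · exact mem_nhdsWithin_of_mem_nhds (isOpen_ne.mem_nhds h)
    filter_upwards [hUcd z₀ hz₀, hPcd z₀, hne2, mem_nhdsWithin_of_mem_nhds (hO1.mem_nhds hz₀re), mem_nhdsWithin_of_mem_nhds (Metric.isOpen_ball.mem_nhds hz₀)]
      with z hzU hzP hz2 hz1 hzb
    exact ⟨⟨⟨hz1, hzb⟩, hzU⟩, by rintro (hP | h2); exacts [hzP hP, hz2 h2]⟩

variable (L : Type) [Field L] [NumberField L] [IsCMField L]
variable [MeasurableSpace (quasiSplit (↥(maximalRealSubfield L)) L (IsCMField.complexConj L) 3).Adelic] [BorelSpace (quasiSplit (↥(maximalRealSubfield L)) L (IsCMField.complexConj L) 3).Adelic]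

omit [BorelSpace (quasiSplit (↥(maximalRealSubfield L)) L (IsCMField.complexConj L) 3).Adelic] in
/-- **LEFT `G(L⁺)`-INVARIANCE OF THE CONTINUED FAMILY ON `U ∖ P` FROM (E5)**: where `Ec z g = ĥ_j(z)⁻¹·∫ h_j(y)·vX(z)[(g y)⁻¹] dν_G(y)` (★ X2₃ (E5)), `Ec z (γ·x) = Ec z x` for
`γ ∈ Γ = G(L⁺)` — the canonical lift `y ↦ v[y⁻¹]` is left-`Γ`-invariant (★ `lift_quotientSubgroup_mul`). [cite: BernsteinLapid2019, §4 p. 10] -/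
theorem ecinv_of_E5 {μ : Measure (quasiSplit (↥(maximalRealSubfield L)) L (IsCMField.complexConj L) 3).automorphicQuotient} (νG : Measure (quasiSplit (↥(maximalRealSubfield L)) L (IsCMField.complexConj L) 3).Adelic) {k : ℕ} {I : Type} (h : I → (quasiSplit (↥(maximalRealSubfield L)) L (IsCMField.complexConj L) 3).Adelic → ℂ) {U P : Set ℂ} {R : ℝ}
    (hUD : U ⊆ Metric.ball (0 : ℂ) R) (hcov : ∀ z ∈ Metric.ball (0 : ℂ) R, ∃ i, (∫ x, h i x * (((borelHeight x : ℝ≥0) : ℝ) : ℂ) ^ z ∂νG) ≠ 0)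
    (vX : ℂ → HX (↥(maximalRealSubfield L)) L (IsCMField.complexConj L) 3 k μ) (Ec : ℂ → (quasiSplit (↥(maximalRealSubfield L)) L (IsCMField.complexConj L) 3).Adelic → ℂ)
    (hE5 : ∀ j, ∀ z ∈ U, z ∉ P → (∫ x, h j x * (((borelHeight x : ℝ≥0) : ℝ) : ℂ) ^ z ∂νG) ≠ 0 →
      ∀ g : (quasiSplit (↥(maximalRealSubfield L)) L (IsCMField.complexConj L) 3).Adelic, Ec z g = (∫ x, h j x * (((borelHeight x : ℝ≥0) : ℝ) : ℂ) ^ z ∂νG)⁻¹ *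
        ∫ y, h j y * ((vX z : HX (↥(maximalRealSubfield L)) L (IsCMField.complexConj L) 3 k μ) : (quasiSplit (↥(maximalRealSubfield L)) L (IsCMField.complexConj L) 3).automorphicQuotient → ℂ) ((quasiSplit (↥(maximalRealSubfield L)) L (IsCMField.complexConj L) 3).toAutomorphicQuotient (g * y)⁻¹) ∂νG) :
    ∀ z ∈ U, z ∉ P → ∀ (γ : (quasiSplit (↥(maximalRealSubfield L)) L (IsCMField.complexConj L) 3).arithmeticSubgroup) (x : (quasiSplit (↥(maximalRealSubfield L)) L (IsCMField.complexConj L) 3).Adelic), Ec z ((γ : (quasiSplit (↥(maximalRealSubfield L)) L (IsCMField.complexConj L) 3).Adelic) * x) = Ec z x := by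
  intro z hzU hzP γ x
  obtain ⟨j, hj⟩ := hcov z (hUD hzU)
  have hγ : ((γ : (quasiSplit (↥(maximalRealSubfield L)) L (IsCMField.complexConj L) 3).Adelic)) ∈ (quasiSplit (↥(maximalRealSubfield L)) L (IsCMField.complexConj L) 3).quotientSubgroup := (quasiSplit (↥(maximalRealSubfield L)) L (IsCMField.complexConj L) 3).arithmeticSubgroup_le_quotientSubgroup γ.2
  rw [hE5 j z hzU hzP hj ((γ : (quasiSplit (↥(maximalRealSubfield L)) L (IsCMField.complexConj L) 3).Adelic) * x), hE5 j z hzU hzP hj x]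
  congr 1
  refine integral_congr_ae (Eventually.of_forall fun y => ?_)
  show h j y * _ = h j y * _
  rw [mul_assoc (γ : (quasiSplit (↥(maximalRealSubfield L)) L (IsCMField.complexConj L) 3).Adelic) x y,
    lift_quotientSubgroup_mul ((vX z : HX (↥(maximalRealSubfield L)) L (IsCMField.complexConj L) 3 k μ) : (quasiSplit (↥(maximalRealSubfield L)) L (IsCMField.complexConj L) 3).automorphicQuotient → ℂ) _ hγ (x * y)]

/-! ## §2 HEAD: «(H4-b)₃-sph» from the EXPORTS₃ objects and the operator road, modulo (MS-2)∕(MS-P) -/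

/-- **«(H4-b)₃-sph» ON THE BERNSTEIN–LAPID ROAD, BINDER FORM, MODULO THE TWO MAASS–SELBERG LETTERS** (module docstring).  Binders: structural measures; a trace-zero `δ ≠ 0` of `L`;
`φ₀`; the EXPORTS₃ objects `Ec, P` with their global clauses (normal-form meromorphy, Godement agreement on `{2 < Re}`, `P` closed ∕ co-discrete ∕ `⊆ {Re ≤ 2}`, (E1), (E4), (E2)) and,
ball by ball (index `n` = the ball `ball 0 ((n+1)+2)`, as ★ X2₃), the holomorphy sets `U n`, the test functions `h n j`, their cover, the vector solutions `vX n` and (E5); the operator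
road's per-ball families `Fam n` at ONE level `T₀ n ≥ 1` on `U n ∖ P`; and the two VISIBLE LETTERS (MS-2) (ball index `2`) and (MS-P) (every ball).  Conclusion: the capstone₃ shape
`∃ r ≠ 0, ∀ g, ∃ Ẽ_g, MeromorphicOn Ẽ_g {1 < Re} ∧ DifferentiableOn ℂ Ẽ_g ({1 < Re} ∖ {2}) ∧ (∀ z, 2 < Re z → Ẽ_g z = E(φ₀H^z)(g)) ∧ (z − 2)·Ẽ_g(z) → φ₀·r`.
[cite: MoeglinWaldspurger1995, IV.1.9–IV.1.11, IV.3.12] [cite: BernsteinLapid2019, Thm 2.3 and §4 p. 10] [cite: Langlands1976, §7] -/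
theorem sphericalEisenstein_continuation_cm_three_of_road
    (μ : Measure (quasiSplit (↥(maximalRealSubfield L)) L (IsCMField.complexConj L) 3).automorphicQuotient) [(quasiSplit (↥(maximalRealSubfield L)) L (IsCMField.complexConj L) 3).IsAutomorphicMeasure μ] (νG : Measure (quasiSplit (↥(maximalRealSubfield L)) L (IsCMField.complexConj L) 3).Adelic)
    (ν : Measure ↥(adelicUnipotent (↥(maximalRealSubfield L)) L (IsCMField.complexConj L) 3)) [ν.IsHaarMeasure]
    {𝓕 : Set ↥(adelicUnipotent (↥(maximalRealSubfield L)) L (IsCMField.complexConj L) 3)}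
    (h𝓕N : IsFundamentalDomain ↥(rationalUnipotent (↥(maximalRealSubfield L)) L (IsCMField.complexConj L) 3) 𝓕 ν) (h𝓕c : IsCompact (closure 𝓕))
    {δ : L} (hcδ : IsCMField.complexConj L δ = -δ) (hδ : δ ≠ 0) (φ₀ : ℂ)
    -- the EXPORTS₃ global objects and clauses
    (Ec : ℂ → (quasiSplit (↥(maximalRealSubfield L)) L (IsCMField.complexConj L) 3).Adelic → ℂ) (P : Set ℂ) (hNF : ∀ g, MeromorphicNFOn (fun z => Ec z g) univ)
    (hEcE : ∀ z : ℂ, 2 < z.re → Ec z = eisensteinSeriesU (flatSectionU (fun _ : (quasiSplit (↥(maximalRealSubfield L)) L (IsCMField.complexConj L) 3).Adelic => φ₀) z))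
    (hPc : IsClosed P) (hPcd : ∀ z₀ : ℂ, ∀ᶠ s in 𝓝[≠] z₀, s ∉ P) (hPre : ∀ z ∈ P, z.re ≤ 2)
    (hE1 : ∀ g (z : ℂ), z ∉ P → AnalyticAt ℂ (fun z => Ec z g) z) (hE4 : ∀ z : ℂ, z ∉ P → Continuous (Ec z))
    (hE2 : ∀ z₀ : ℂ, z₀ ∉ P → ∀ K : Set (quasiSplit (↥(maximalRealSubfield L)) L (IsCMField.complexConj L) 3).Adelic, IsCompact K → ∃ V ∈ 𝓝 z₀, ∃ M : ℝ, ∀ z ∈ V, ∀ g ∈ K, ‖Ec z g‖ ≤ M)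
    -- the EXPORTS₃ per-ball objects used here (index `n` = the ball `ball 0 ((n+1)+2)`, weight `(n+1)+4`)
    (I : ℕ → Type) (h : (n : ℕ) → I n → (quasiSplit (↥(maximalRealSubfield L)) L (IsCMField.complexConj L) 3).Adelic → ℂ) (U : ℕ → Set ℂ) (vX : (n : ℕ) → ℂ → HX (↥(maximalRealSubfield L)) L (IsCMField.complexConj L) 3 (n + 1 + 4) μ)
    (hUo : ∀ n, IsOpen (U n)) (hUD : ∀ n, U n ⊆ Metric.ball (0 : ℂ) (((n + 1 : ℕ) : ℝ) + 2)) (hUcd : ∀ n, ∀ z₀ ∈ Metric.ball (0 : ℂ) (((n + 1 : ℕ) : ℝ) + 2), ∀ᶠ s in 𝓝[≠] z₀, s ∈ U n)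
    (hcov : ∀ n, ∀ z ∈ Metric.ball (0 : ℂ) (((n + 1 : ℕ) : ℝ) + 2), ∃ i, (∫ x, h n i x * (((borelHeight x : ℝ≥0) : ℝ) : ℂ) ^ z ∂νG) ≠ 0)
    (hE5 : ∀ n j, ∀ z ∈ U n, z ∉ P → (∫ x, h n j x * (((borelHeight x : ℝ≥0) : ℝ) : ℂ) ^ z ∂νG) ≠ 0 →
      ∀ g : (quasiSplit (↥(maximalRealSubfield L)) L (IsCMField.complexConj L) 3).Adelic, Ec z g = (∫ x, h n j x * (((borelHeight x : ℝ≥0) : ℝ) : ℂ) ^ z ∂νG)⁻¹ *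
        ∫ y, h n j y * ((vX n z : HX (↥(maximalRealSubfield L)) L (IsCMField.complexConj L) 3 (n + 1 + 4) μ) : (quasiSplit (↥(maximalRealSubfield L)) L (IsCMField.complexConj L) 3).automorphicQuotient → ℂ) ((quasiSplit (↥(maximalRealSubfield L)) L (IsCMField.complexConj L) 3).toAutomorphicQuotient (g * y)⁻¹) ∂νG)
    -- the operator road: one truncated `L²` family per ball, at one level, on `U n ∖ P` (★ closer₃)
    (T₀ : ℕ → ℝ≥0) (hT₀ : ∀ n, 1 ≤ T₀ n) (Fam : ℕ → ℂ → (quasiSplit (↥(maximalRealSubfield L)) L (IsCMField.complexConj L) 3).L2 μ) (hFd : ∀ n, DifferentiableOn ℂ (Fam n) (U n \ P))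
    (hFam : ∀ n, ∀ z ∈ U n \ P, ((Fam n z : (quasiSplit (↥(maximalRealSubfield L)) L (IsCMField.complexConj L) 3).L2 μ) : (quasiSplit (↥(maximalRealSubfield L)) L (IsCMField.complexConj L) 3).automorphicQuotient → ℂ) =ᵐ[μ] (quasiSplit (↥(maximalRealSubfield L)) L (IsCMField.complexConj L) 3).quotFun (truncation ν 𝓕 (T₀ n) (Ec z)))
    -- THE TWO VISIBLE LETTERS: (MS-2) at the pole, on the ball of index 2; (MS-P) `L²` pole exclusion near every other pole, on every ball containing it
    (hMS2 : ∃ C : ℝ, ∀ᶠ z in 𝓝[≠] (2 : ℂ), ‖(z - 2) • Fam 2 z‖ ≤ C)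
    (hMSP : ∀ n, ∀ z₀ ∈ P, 1 < z₀.re → z₀ ≠ 2 → z₀ ∈ Metric.ball (0 : ℂ) (((n + 1 : ℕ) : ℝ) + 2) → ∃ C : ℝ, ∀ᶠ z in 𝓝[≠] z₀, ‖Fam n z‖ ≤ C) :
    ∃ r : ℂ, r ≠ 0 ∧ ∀ g : (quasiSplit (↥(maximalRealSubfield L)) L (IsCMField.complexConj L) 3).Adelic, ∃ Eg : ℂ → ℂ,
      MeromorphicOn Eg {z : ℂ | 1 < z.re} ∧ DifferentiableOn ℂ Eg ({z : ℂ | 1 < z.re} \ {2}) ∧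
      (∀ z : ℂ, 2 < z.re → Eg z = eisensteinSeriesU (flatSectionU (fun _ : (quasiSplit (↥(maximalRealSubfield L)) L (IsCMField.complexConj L) 3).Adelic => φ₀) z) g) ∧
      Tendsto (fun z : ℂ => (z - 2) * Eg z) (𝓝[≠] 2) (𝓝 (φ₀ * r)) := by
  -- (L3)₃: the continued constant-term scalar `c`, and the tube constant term ★ (Ξ₂)₃ in its currency
  obtain ⟨c, r, hr, hcmer, hchol, hcres, hceq⟩ := sphericalConstantTerm_continuation_cm_three_one L hcδ hδ ν h𝓕N h𝓕c
  have hccE : ∀ z : ℂ, 2 < z.re → ∀ g : (quasiSplit (↥(maximalRealSubfield L)) L (IsCMField.complexConj L) 3).Adelic, borelConstantTerm ν 𝓕 (eisensteinSeriesU (flatSectionU (fun _ : (quasiSplit (↥(maximalRealSubfield L)) L (IsCMField.complexConj L) 3).Adelic => φ₀) z)) g =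
      φ₀ * ((((borelHeight g : ℝ≥0) : ℝ) : ℂ) ^ z + c z * (((borelHeight g : ℝ≥0) : ℝ) : ℂ) ^ (2 - z)) := fun z hz g => by
    rw [borelConstantTerm_sphericalEisenstein_cm_three L ν h𝓕N h𝓕c φ₀ hz g, hceq z hz]
  have hcan : ∀ z₀ : ℂ, 1 < z₀.re → z₀ ≠ 2 → AnalyticAt ℂ c z₀ := fun z₀ hz₀ hz₀2 =>
    hchol.analyticOnNhd ((isOpen_lt continuous_const Complex.continuous_re).sdiff isClosed_singleton) z₀ ⟨hz₀, hz₀2⟩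
  -- the radii of the balls are at least `5` from index `2` on
  have hR : ∀ n : ℕ, 2 ≤ n → (5 : ℝ) ≤ ((n + 1 : ℕ) : ℝ) + 2 := fun n hn => by
    have : (2 : ℝ) ≤ n := by exact_mod_cast hn
    push_cast; linarith
  -- the letters of ★ FILE A on the ball domain of index `n ≥ 2`
  have hball : ∀ n : ℕ, 2 ≤ n → ∃ D : Set ℂ, IsOpen D ∧ IsPreconnected D ∧ D ⊆ {z : ℂ | 1 < z.re} \ {2} ∧
      (∃ σ₀ : ℝ, 2 < σ₀ ∧ ∀ᶠ z in 𝓝 ((σ₀ : ℝ) : ℂ), z ∈ D) ∧ (∃ ρ : ℝ, 0 < ρ ∧ ∀ z : ℂ, z ≠ 2 → dist z 2 < ρ → z ∈ D) ∧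
      (∀ z₀ ∈ Metric.ball (0 : ℂ) (((n + 1 : ℕ) : ℝ) + 2), 1 < z₀.re → ∀ᶠ z in 𝓝[≠] z₀, z ∈ D) ∧ D ⊆ U n \ P ∧
      (∀ g, DifferentiableOn ℂ (fun z => Ec z g) D) ∧ (∀ z ∈ D, Continuous (Ec z)) ∧
      (∀ z₀ ∈ D, ∀ K : Set (quasiSplit (↥(maximalRealSubfield L)) L (IsCMField.complexConj L) 3).Adelic, IsCompact K → ∃ V ∈ 𝓝 z₀, ∃ M : ℝ, ∀ z ∈ V, ∀ g ∈ K, ‖Ec z g‖ ≤ M) ∧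
      (∀ z ∈ D, ∀ (γ : (quasiSplit (↥(maximalRealSubfield L)) L (IsCMField.complexConj L) 3).arithmeticSubgroup) (x : (quasiSplit (↥(maximalRealSubfield L)) L (IsCMField.complexConj L) 3).Adelic), Ec z ((γ : (quasiSplit (↥(maximalRealSubfield L)) L (IsCMField.complexConj L) 3).Adelic) * x) = Ec z x) ∧
      (∀ z ∈ D, 2 < z.re → Ec z = eisensteinSeriesU (flatSectionU (fun _ : (quasiSplit (↥(maximalRealSubfield L)) L (IsCMField.complexConj L) 3).Adelic => φ₀) z)) ∧
      DifferentiableOn ℂ (Fam n) D ∧ (∀ z ∈ D, ((Fam n z : (quasiSplit (↥(maximalRealSubfield L)) L (IsCMField.complexConj L) 3).L2 μ) : (quasiSplit (↥(maximalRealSubfield L)) L (IsCMField.complexConj L) 3).automorphicQuotient → ℂ) =ᵐ[μ] (quasiSplit (↥(maximalRealSubfield L)) L (IsCMField.complexConj L) 3).quotFun (truncation ν 𝓕 (T₀ n) (Ec z))) := by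
    intro n hn
    obtain ⟨D, hDdef, hDo, hDc, hD1, hσ, hρ, hnbhd⟩ := exists_ballDomain (hR n hn) (hUo n) (hUcd n) hPc hPcd hPre
    have hDU : D ⊆ U n \ P := fun z hz => by
      rw [hDdef] at hz
      exact ⟨hz.1.2, fun hP => hz.2 (Or.inl hP)⟩
    have hinv := ecinv_of_E5 L νG (h n) (hUD n) (hcov n) (vX n) Ec (hE5 n)
    exact ⟨D, hDo, hDc, hD1, hσ, hρ, hnbhd, hDU, fun g z hz => (hE1 g z (hDU hz).2).differentiableAt.differentiableWithinAt, fun z hz => hE4 z (hDU hz).2,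
      fun z₀ hz₀ K hK => hE2 z₀ (hDU hz₀).2 K hK, fun z hz => hinv z (hDU hz).1 (hDU hz).2, fun z _ hz2 => hEcE z hz2,
      (hFd n).mono hDU, fun z hz => hFam n z (hDU hz)⟩
  -- `hres` on the ball of index `2` (radius `5`), with (MS-2)
  have hres : ∀ g : (quasiSplit (↥(maximalRealSubfield L)) L (IsCMField.complexConj L) 3).Adelic, ∃ G : ℂ → ℂ, AnalyticAt ℂ G 2 ∧ G =ᶠ[𝓝[≠] 2] (fun z => Ec z g -
      φ₀ * ((((borelHeight g : ℝ≥0) : ℝ) : ℂ) ^ z + c z * (((borelHeight g : ℝ≥0) : ℝ) : ℂ) ^ ((2 : ℂ) - z))) := by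
    obtain ⟨D, hDo, hDc, hD1, ⟨σ₀, hσ₀, hσD⟩, ⟨ρ, hρ, hρD⟩, -, -, hEd, hE4D, hEbdD, hEcinvD, hE2D, hFdD, hFamD⟩ := hball 2 le_rfl
    exact hres_cm_three_on_domain L μ ν h𝓕N h𝓕c φ₀ (hT₀ 2) Ec hDo hDc hD1 hσ₀ hσD hρ hρD hEd hE4D hEbdD hEcinvD hE2D hchol hcres hccE (Fam 2) hFdD hFamD hMS2
  -- `hbdd` at every pole `z₀ ≠ 2` with `1 < Re z₀`, on the ball of index `max 2 ⌈‖z₀‖⌉₊`, with (MS-P)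
  have hbdd : ∀ g : (quasiSplit (↥(maximalRealSubfield L)) L (IsCMField.complexConj L) 3).Adelic, ∀ z₀ : ℂ, 1 < z₀.re → z₀ ∈ P ∪ {2} → z₀ ≠ 2 → ∃ C : ℝ, ∀ᶠ z in 𝓝[≠] z₀, ‖Ec z g‖ ≤ C := by
    intro g z₀ hz₀ hz₀P hz₀2
    have hz₀P' : z₀ ∈ P := hz₀P.resolve_right hz₀2
    have hz₀b : z₀ ∈ Metric.ball (0 : ℂ) (((max 2 ⌈‖z₀‖⌉₊ + 1 : ℕ) : ℝ) + 2) := by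
      have h1 : (⌈‖z₀‖⌉₊ : ℝ) ≤ ((max 2 ⌈‖z₀‖⌉₊ : ℕ) : ℝ) := by exact_mod_cast le_max_right 2 ⌈‖z₀‖⌉₊
      rw [mem_ball_zero_iff, Nat.cast_add, Nat.cast_one]
      linarith [Nat.le_ceil ‖z₀‖]
    obtain ⟨D, hDo, hDc, hD1, ⟨σ₀, hσ₀, hσD⟩, -, hnbhd, -, hEd, hE4D, hEbdD, hEcinvD, hE2D, -, hFamD⟩ := hball (max 2 ⌈‖z₀‖⌉₊) (le_max_left _ _)
    exact hbdd_cm_three_on_domain L μ ν h𝓕N h𝓕c φ₀ (hT₀ _) Ec hDo hDc hD1 hσ₀ hσD hEd hE4D hEbdD hEcinvD hE2D hchol hccE (Fam _) hFamD hz₀ hz₀2 (hnbhd z₀ hz₀b hz₀)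
      (hMSP _ z₀ hz₀P' hz₀ hz₀2 hz₀b) g
  -- ★ `hreg_cm_three_of_letters` with the pole set `P ∪ {2}`, then the capstone₃ engine
  have hreg := hreg_cm_three_of_letters L φ₀ c hcan Ec (P ∪ {2})
    (by rintro z (hz | hz); exacts [hPre z hz, by rw [mem_singleton_iff] at hz; rw [hz, Complex.re_ofNat]])
    (fun g z₀ _ => (hNF g (mem_univ z₀)).meromorphicAt) (fun g z₀ _ hz₀P _ => hE1 g z₀ fun hP => hz₀P (Or.inl hP))
    (fun g z hz => congrFun (hEcE z hz) g) hbdd hres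
  exact sphericalEisenstein_continuation_cm_three_of_letters L c r hr hcmer hchol hcres φ₀ hreg

end Summit.HodgeConjecture.HodgeConjecture.Cruxes.H413.K2E1SphericalEisensteinPoleControlCMThreeFinal

end
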